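import Summits.CriticalPhenomena.PercolationContinuityZ3.Theses.PercAnnulusCrossing
import Summits.CriticalPhenomena.PercolationContinuityZ3.Theorems.PercNonProliferationSubpolynomialBlockingUniquenessCrossRoute
import Summits.CriticalPhenomena.PercolationContinuityZ3.Theorems.SubpolynomialBlocking.Negative.AnchorComparisonShape
import HarnessLib

/-!
# `BlockerRSW3D` (stmt-CriticalPhenomena-1129) — redirect strategist r1: the FIXED-SCALE truncation is a theorem

`BlockerRSW3D` asks for ONE monotone `f`, positive on `(0, ∞)`, with
`f(q_n(p)) ≤ w_n(p)` for EVERY `p ∈ [0,1]` and EVERY `n ≥ 1`, where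
`q_n(p) = P_p([0,n]³ sealed across direction 0)` and `w_n(p) = P_p([0,n] × [0,2n]² sealed across direction 0)`
(the Benjamini–Kalai "RSW for plaquettes in cubes").

This file certifies the claim of the r1 census that **every fixed-scale truncation of the crux is
trivially true by finite energy**: for each fixed `n ≥ 1` the explicit function
`f_n(s) = (max 0 (min s 1) / n) ^ m_n`, `m_n = #(pairs of the wide box)`, works uniformly in `p`
(`blockerRSW3D_fixedScale`), because `q_n(p) ≤ 1 - p^n ≤ n (1 - p)` (a straight open column crosses
the cube; Bernoulli) and `w_n(p) ≥ (1 - p)^{m_n}` (close every pair of the wide box). Hence the whole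
content of the crux is the UNIFORMITY `n → ∞` (the constants `f_n` degenerate like `(s/n)^{O(n³)}`),
and a fixed-`n` instance is NOT a BC5/T3 witness (it does not exercise the route's lever).
`fixedScale_of_blockerRSW3D` records that the truncation is indeed implied by the crux (quantifier
exchange), i.e. it is a genuine special case. No Theses statement is asserted.
-/

noncomputable section

namespace Summit.CriticalPhenomena.PercolationContinuityZ3.Cruxes.BlockerRSW3D.Rung

open MeasureTheory
open Literature.Probability.Percolation Literature.Probability.LatticeModels
open Summit.CriticalPhenomena.PercolationContinuityZ3.Theses
open Summit.CriticalPhenomena.PercolationContinuityZ3.Theorems.SubpolynomialBlocking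
open Summit.CriticalPhenomena.PercolationContinuityZ3.Theorems.SubpolynomialBlocking.Negative

/-- The cube-seal probability `q_n(p)` in the item's `Finset.Icc` spelling. -/
def cubeSealI (p : unitInterval) (n : ℕ) : ℝ :=
  (bondPercolation (zdGraph 3) p).real
    {ω | ¬ ∃ x ∈ Finset.Icc (0 : Site 3) ![(n : ℤ), n, n], ∃ y ∈ Finset.Icc (0 : Site 3) ![(n : ℤ), n, n],
      x 0 = 0 ∧ y 0 = n ∧ ω ∈ openConnIn ↑(Finset.Icc (0 : Site 3) ![(n : ℤ), n, n]) x y}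

/-- The wide-box-seal probability `w_n(p)` in the item's `Finset.Icc` spelling. -/
def wideSealI (p : unitInterval) (n : ℕ) : ℝ :=
  (bondPercolation (zdGraph 3) p).real
    {ω | ¬ ∃ x ∈ Finset.Icc (0 : Site 3) ![(n : ℤ), 2 * n, 2 * n],
      ∃ y ∈ Finset.Icc (0 : Site 3) ![(n : ℤ), 2 * n, 2 * n],
        x 0 = 0 ∧ y 0 = n ∧ ω ∈ openConnIn ↑(Finset.Icc (0 : Site 3) ![(n : ℤ), 2 * n, 2 * n]) x y}

/-- Readback: the crux IS `∃ f, Monotone f ∧ (∀ s > 0, 0 < f s) ∧ ∀ p n, 1 ≤ n → f (q_n p) ≤ w_n p`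
(definitional). -/
theorem blockerRSW3D_iff :
    PercAnnulusCrossing.BlockerRSW3D ↔
      ∃ f : ℝ → ℝ, Monotone f ∧ (∀ s, 0 < s → 0 < f s) ∧
        ∀ (p : unitInterval) (n : ℕ), 1 ≤ n → f (cubeSealI p n) ≤ wideSealI p n :=
  Iff.rfl

/-- The FIXED-SCALE truncation of the crux: the scale quantifier moved inside the existential. -/
def BlockerRSW3DFixedScale : Prop :=
  ∀ n : ℕ, 1 ≤ n → ∃ f : ℝ → ℝ, Monotone f ∧ (∀ s, 0 < s → 0 < f s) ∧
    ∀ p : unitInterval, f (cubeSealI p n) ≤ wideSealI p n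

/-- The truncation is a special case of the crux (quantifier exchange). -/
theorem fixedScale_of_blockerRSW3D (h : PercAnnulusCrossing.BlockerRSW3D) : BlockerRSW3DFixedScale := by
  obtain ⟨f, hf, hpos, hle⟩ := h
  exact fun n hn => ⟨f, hf, hpos, fun p => hle p n hn⟩

/-- `q_n(p)` is the `cubeSeal` of `Negative.AnchorComparisonShape` (same set). -/
theorem cubeSealI_eq (p : unitInterval) (n : ℕ) : cubeSealI p n = cubeSeal p n := by
  rw [cubeSealI, StubBlockerRSWGlue.sealEvent_eq, cubeSeal_eq]

/-- `q_n(p) ≤ n (1 - p)`: a straight open column crosses the cube (`cubeSeal_le_one_sub_pow`) and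
Bernoulli's inequality `p^n ≥ 1 - n(1-p)`. -/
theorem cubeSealI_le (p : unitInterval) (n : ℕ) : cubeSealI p n ≤ n * (1 - (p : ℝ)) := by
  have h1 : cubeSealI p n ≤ 1 - (p : ℝ) ^ n := by
    rw [cubeSealI_eq]; exact cubeSeal_le_one_sub_pow p n
  have hp0 : 0 ≤ (p : ℝ) := p.2.1
  have hB := one_add_mul_le_pow (a := (p : ℝ) - 1) (by linarith) n
  have : (1 + ((p : ℝ) - 1)) ^ n = (p : ℝ) ^ n := by ring_nf
  rw [this] at hB
  linarith

/-- Finite energy for the wide box: `(1 - p)^{#pairs} ≤ w_n(p)` (`n ≥ 1`). -/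
theorem pow_le_wideSealI (p : unitInterval) {n : ℕ} (hn : 1 ≤ n) :
    (1 - (p : ℝ)) ^ ((Finset.Icc (0 : Site 3) ![(n : ℤ), 2 * n, 2 * n]).sym2).card ≤ wideSealI p n := by
  have hnz : (n : ℤ) ≠ 0 := by exact_mod_cast (show n ≠ 0 by omega)
  exact (le_bondPercolation_real_forall_notMem (zdGraph 3) p
      ((Finset.Icc (0 : Site 3) ![(n : ℤ), 2 * n, 2 * n]).sym2)).trans
    (measureReal_mono (UniquenessCrossRoute.forall_notMem_subset_seal _ hnz) (measure_ne_top _ _))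

/-- **The fixed-scale truncation of `BlockerRSW3D` holds**, with the explicit
`f_n(s) = (max 0 (min s 1) / n) ^ m_n`. -/
theorem blockerRSW3D_fixedScale : BlockerRSW3DFixedScale := by
  intro n hn
  set m : ℕ := ((Finset.Icc (0 : Site 3) ![(n : ℤ), 2 * n, 2 * n]).sym2).card with hm
  have hn0 : (0 : ℝ) < n := by exact_mod_cast hn
  refine ⟨fun s => (max 0 (min s 1) / n) ^ m, ?_, ?_, ?_⟩
  · intro a b hab
    exact pow_le_pow_left₀ (div_nonneg (le_max_left _ _) hn0.le)
      (div_le_div_of_nonneg_right (max_le_max le_rfl (min_le_min hab le_rfl)) hn0.le) m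
  · intro s hs
    have : 0 < max 0 (min s 1) := lt_max_of_lt_right (lt_min hs one_pos)
    positivity
  · intro p
    have hs0 : 0 ≤ cubeSealI p n := measureReal_nonneg
    have hbase : max 0 (min (cubeSealI p n) 1) / n ≤ 1 - (p : ℝ) := by
      rw [div_le_iff₀ hn0]
      calc max 0 (min (cubeSealI p n) 1) ≤ cubeSealI p n := max_le hs0 (min_le_left _ _)
        _ ≤ n * (1 - (p : ℝ)) := cubeSealI_le p n
        _ = (1 - (p : ℝ)) * n := by ring
    calc (max 0 (min (cubeSealI p n) 1) / n) ^ m ≤ (1 - (p : ℝ)) ^ m :=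
          pow_le_pow_left₀ (div_nonneg (le_max_left _ _) hn0.le) hbase m
      _ ≤ wideSealI p n := pow_le_wideSealI p hn

end Summit.CriticalPhenomena.PercolationContinuityZ3.Cruxes.BlockerRSW3D.Rung
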